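import Summits.CriticalPhenomena.CardyFormulaZ2.Theorems.CardyComplexConeSLESixFamiliesGiveCardySmoothMarkFamiliesPart1
import Literature.Probability.RandomPlanarGeometry.PlanarDomainsTopology
import HarnessLib

/-!
# drefute gen-7 — registered helper `smoothMark_part10` (STUB F, part 10/10): candidate proof

`smoothMark_part10` (registered 2026-08-16T05:18Z): a `zdBoundary` site of `⟨D.carrier, δ, ∅, ∅⟩`
is within `6δ` of the arc `D.arc j` as soon as EITHER it is within `6δ` of a marked point (both marks
lie on both arcs: `pt_mem_arc_self`, `pt_succ_mem_arc`) OR it is at least as close to `D.arc j` as to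
the other arc (then `infDist` to `D.arc j` is the `infDist` to `frontier D = D.arc 0 ∪ D.arc 1`, which is
`≤ 2δ` by the LANDED `smoothMark_part1`).  Proof below; `6δ` could be `2δ` in the second branch
(tightness remark for the prover, not needed).
-/

noncomputable section

open Set Metric
open Literature.Probability Literature.Probability.RandomPlanarGeometry
  Literature.Probability.LatticeModels

namespace Summit.CriticalPhenomena.CardyFormulaZ2.Cruxes.SLESixFamiliesGiveCardy.CollarTouchSandwich
namespace DrefuteG7

/-- For a Dobrushin domain, `D.arc j ∪ D.arc (j + 1)` is the whole frontier. -/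
theorem arc_union_arc_succ (D : DobrushinDomain) (j : Fin 2) :
    D.arc j ∪ D.arc (j + 1) = frontier D.carrier := by
  have h : (⋃ i, D.arc i) = frontier D.carrier := D.iUnion_arc_holds
  rw [← h]
  ext z
  simp only [mem_union, mem_iUnion]
  constructor
  · rintro (hz | hz)
    · exact ⟨j, hz⟩
    · exact ⟨j + 1, hz⟩
  · rintro ⟨i, hi⟩
    fin_cases j <;> fin_cases i
    · exact Or.inl hi
    · exact Or.inr hi
    · exact Or.inr (by simpa using hi)
    · exact Or.inl hi

/-- `infDist` to a union of two nonempty sets is the minimum (local copy of the folklore lemma). -/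
theorem infDist_union' {α : Type*} [PseudoMetricSpace α] (x : α) {s t : Set α} (hs : s.Nonempty)
    (ht : t.Nonempty) :
    Metric.infDist x (s ∪ t) = min (Metric.infDist x s) (Metric.infDist x t) := by
  simp only [Metric.infDist, Metric.infEDist_union]
  exact ENNReal.toReal_min (Metric.infEDist_ne_top hs) (Metric.infEDist_ne_top ht)

/-- **`smoothMark_part10` verbatim (registered signature).** -/
theorem smoothMark_part10_proof : ∀ (D : DobrushinDomain) (δ : ℝ), 0 < δ → ∀ x : Site 2, x ∈ (⟨D.carrier, δ, ∅, ∅⟩ : DiscreteDobrushin).zdBoundary → ∀ j : Fin 2, ((∃ i : Fin 2, dist (meshPoint δ x) (D.pt i) < 6 * δ) ∨ Metric.infDist (meshPoint δ x) (D.arc j) ≤ Metric.infDist (meshPoint δ x) (D.arc (j + 1))) → Metric.infDist (meshPoint δ x) (D.arc j) ≤ 6 * δ := by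
  intro D δ hδ x hx j h
  rcases h with ⟨i, hi⟩ | h
  · -- both marks lie on both arcs
    have hpt : D.pt i ∈ D.arc j := by
      fin_cases i <;> fin_cases j
      · exact D.pt_mem_arc_self 0
      · simpa using D.pt_succ_mem_arc 1
      · simpa using D.pt_succ_mem_arc 0
      · exact D.pt_mem_arc_self 1
    exact (Metric.infDist_le_dist_of_mem hpt).trans hi.le
  · have h1 := smoothMark_part1 (⟨D.carrier, δ, ∅, ∅⟩ : DiscreteDobrushin) D.isOpen hδ.le x hx
    -- `infDist` to the frontier is the minimum over the two arcs
    have hfr : Metric.infDist (meshPoint δ x) (frontier D.carrier) =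
        min (Metric.infDist (meshPoint δ x) (D.arc j)) (Metric.infDist (meshPoint δ x) (D.arc (j + 1))) := by
      rw [← arc_union_arc_succ D j]
      exact infDist_union' _ ⟨_, D.pt_mem_arc_self j⟩ ⟨_, D.pt_mem_arc_self (j + 1)⟩
    rw [min_eq_left h] at hfr
    change Metric.infDist (meshPoint δ x) (frontier D.carrier) ≤ 2 * δ at h1
    linarith

end DrefuteG7
end Summit.CriticalPhenomena.CardyFormulaZ2.Cruxes.SLESixFamiliesGiveCardy.CollarTouchSandwich

end
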